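import Summits.NavierStokesRegularity.NavierStokesRegularity.Theorems.ScenarioCensusRowA5FsBox
import HarnessLib

/-!
# Census rows A5fe / A5fi (ns-idea-4 LINE «one-cycle» = the Feller–swirl dictionary) — part 2/7: §0 statements of record (O1/O2/K1, `row_A5_of`, item ⟨2003⟩ glue), §1 the bounded-drift swirl-pair class, §2 the certified Feller dictionary (radial operator, core-leak profile)

Part 2 of 7 of the port of `OneCycle_v2_3.lean` (sha16 f100b791173babd1); see `ScenarioCensusRowA5FsBox.lean` for the port note.
No census value is asserted here; Row_A5 and NS regularity are NOT proved; no summit statement is proved by this file.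
-/

noncomputable section
set_option linter.dupNamespace false

open MeasureTheory Set Function Filter Topology InnerProductSpace
open scoped Laplacian RealInnerProductSpace ContDiff ENNReal

namespace Summit.NavierStokesRegularity.NavierStokesRegularity.Theorems.ScenarioCensus.FellerSwirl

open Literature.Analysis.FluidPDE
open Summit.NavierStokesRegularity.NavierStokesRegularity.Theorems.ScenarioCensus (Row_A5 Row_A5fe Row_A5fi row_A5fi_of_row_A5fe)

/-- Physical space. -/
abbrev E3 := EuclideanSpace ℝ (Fin 3)

/-! ## §0  The statements of record (VERBATIM from LINE «feller-swirl» v1.1 / «one-cycle» v2.3; same decl names and signatures).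
PORT NOTE: the two census-row Props `EventualFellerSwirlLiouville` / `FellerSwirlLiouville` of the pub file are NOT restated here —
the TREE decls `ScenarioCensus.Row_A5fe` / `ScenarioCensus.Row_A5fi` (`ScenarioCensusSubRows.lean`, verbatim the same text) are used
BY NAME instead, and `row_A5fi_of_row_A5fe` (tree) replaces the pub file's `fellerSwirlLiouville_of_eventual`. -/

/-- **O1 of feller-swirl (support).** Verbatim. -/
def FellerCore : Prop :=
  ∀ (f : ℝ → E3 → ℝ) (u : ℝ → E3 → E3) (Cf Cg Cu δ : ℝ), 0 < δ →
    (∀ t < 0, ContDiff ℝ ∞ (f t)) →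
    ContinuousOn (fun p : ℝ × E3 => fderiv ℝ (f p.1) p.2) (Iio 0 ×ˢ univ) →
    ContinuousOn (fun p : ℝ × E3 => (Δ (f p.1)) p.2) (Iio 0 ×ˢ univ) →
    (∀ t < 0, ∀ x, |f t x| ≤ Cg * cylRadius x) →
    (∀ t < 0, ∀ x, |f t x| ≤ Cf) →
    Measurable (uncurry u) →
    (∀ t < 0, ∀ x, ‖u t x‖ ≤ Cu) →
    (∀ t < 0, ∀ x, -(2 - δ) ≤ x 0 * u t x 0 + x 1 * u t x 1) →
    (∀ x, cylRadius x ≠ 0 → ∀ s t : ℝ, s ≤ t → t < 0 →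
      f t x - f s x = ∫ τ in s..t, ((Δ (f τ)) x - fderiv ℝ (f τ) x (u τ x) -
        2 / cylRadius x * partialDeriv (eR x) (f τ) x)) →
    ∀ t < 0, ∀ x, f t x = 0

/-- **O2 of feller-swirl (support, "provable now, L") — THE STATEMENT THIS LINE ATTACKS.** Verbatim. EVENTUAL one-sided
swirl Liouville: a bounded-drift swirl pair whose inflow number `−(x₀u₀+x₁u₁) = −r u_r` is at most `2 − δ` on
`{r ≥ R₀}` vanishes identically. -/
def EventualFellerCore : Prop :=
  ∀ (f : ℝ → E3 → ℝ) (u : ℝ → E3 → E3) (Cf Cg Cu δ R₀ : ℝ), 0 < δ →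
    (∀ t < 0, ContDiff ℝ ∞ (f t)) →
    ContinuousOn (fun p : ℝ × E3 => fderiv ℝ (f p.1) p.2) (Iio 0 ×ˢ univ) →
    ContinuousOn (fun p : ℝ × E3 => (Δ (f p.1)) p.2) (Iio 0 ×ˢ univ) →
    (∀ t < 0, ∀ x, |f t x| ≤ Cg * cylRadius x) →
    (∀ t < 0, ∀ x, |f t x| ≤ Cf) →
    Measurable (uncurry u) →
    (∀ t < 0, ∀ x, ‖u t x‖ ≤ Cu) →
    (∀ t < 0, ∀ x, R₀ ≤ cylRadius x → -(2 - δ) ≤ x 0 * u t x 0 + x 1 * u t x 1) →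
    (∀ x, cylRadius x ≠ 0 → ∀ s t : ℝ, s ≤ t → t < 0 →
      f t x - f s x = ∫ τ in s..t, ((Δ (f τ)) x - fderiv ℝ (f τ) x (u τ x) -
        2 / cylRadius x * partialDeriv (eR x) (f τ) x)) →
    ∀ t < 0, ∀ x, f t x = 0

/-- PROVED (verbatim). The eventual core contains the global one (`R₀ := 0`). -/
theorem fellerCore_of_eventual (h : EventualFellerCore) : FellerCore := by
  intro f u Cf Cg Cu δ hδ h1 h2 h3 h4 hM h6 h7 hone h8
  exact h f u Cf Cg Cu δ 0 hδ h1 h2 h3 h4 hM h6 h7 (fun t ht x _ => hone t ht x) h8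

/-- **K1 of feller-swirl (verbatim; declared row-A5-strength there).** -/
def FarFieldInflowBound : Prop :=
  ∀ u : ℝ → E3 → E3, IsBoundedAncientMildSolution 1 u →
    (∀ t < 0, AEStronglyMeasurable (u t) volume) →
      (∀ t < 0, IsAxisymmetric (u t)) →
        (∃ C : ℝ, ∀ t < 0, ∀ x, |swirl (u t) x| ≤ C) →
          ∃ δ : ℝ, 0 < δ ∧ ∃ R₀ : ℝ, ∀ t < 0, ∀ᵐ x ∂volume,
            R₀ ≤ cylRadius x → -(2 - δ) ≤ x 0 * u t x 0 + x 1 * u t x 1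

/-- PROVED (verbatim). K2 and K1 give census row A5 BY NAME. -/
theorem row_A5_of (h₂ : Row_A5fe) (h₁ : FarFieldInflowBound) : Row_A5 :=
  fun u hu hmeas hax hC => h₂ u hu hmeas hax hC (h₁ u hu hmeas hax hC)

/-- PROVED (verbatim). Row A5 implies K1. -/
theorem farFieldInflowBound_of_row_A5 (h : Row_A5) : FarFieldInflowBound := by
  intro u hu hmeas hax hC
  refine ⟨1, one_pos, 0, fun t ht => ?_⟩
  obtain ⟨b, hb⟩ := h u hu hmeas hax hC t ht
  have hbz : b = b 2 • eZ := eq_smul_eZ_of_ae_eq_const_of_isAxisymmetric (hax t ht) hb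
  have hb0 : b 0 = 0 := by
    rw [hbz]; simp [eZ]
  have hb1 : b 1 = 0 := by
    rw [hbz]; simp [eZ]
  filter_upwards [hb] with x hx
  intro _
  rw [hx, hb0, hb1]
  norm_num

/-- PROVED (verbatim). Row A5 implies the dormant crux ⟨stmt-NavierStokesRegularity-2003⟩ BY NAME. -/
theorem swirlCriticalLiouville_of_row_A5 (h : Row_A5) :
    Summit.NavierStokesRegularity.NavierStokesRegularity.Theses.SwirlThreshold.SwirlCriticalLiouville := by
  intro L hL u hu hmeas hax hlt hpos
  have ht : (-1 : ℝ) < 0 := by norm_num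
  obtain ⟨b, hb⟩ := h u hu hmeas hax ⟨L, fun t ht x => (hlt t ht x).le⟩ (-1) ht
  have hbz : b = b 2 • eZ := eq_smul_eZ_of_ae_eq_const_of_isAxisymmetric (hax (-1) ht) hb
  have hb0 : b 0 = 0 := by
    rw [hbz]; simp [eZ]
  have hb1 : b 1 = 0 := by
    rw [hbz]; simp [eZ]
  have hnull : volume {x : E3 | L - L / 2 < |swirl (u (-1)) x|} = 0 := by
    rw [measure_eq_zero_iff_ae_notMem]
    filter_upwards [hb] with x hx
    simp only [not_lt, swirl, hx, hb0, hb1, mul_zero, sub_zero, abs_zero]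
    linarith
  have h' := hpos (-1) ht (L / 2) (by positivity)
  rw [hnull] at h'
  exact lt_irrefl _ h'

/-! ## §1  The bounded-drift swirl-pair class (the data of O2 bundled) and its membership in the tree's local
drift–heat class `IsDriftHeatSolutionOn` (`DriftHeatLocalClass`) off the axis, merged drift `u + (2/r)e_r` — PROVED -/

/-- The unbundled swirl-pair class of O1/O2 (= hypotheses h1–h4, h6–h8 of `EventualFellerCore`), bundled. -/
structure IsSwirlPair (f : ℝ → E3 → ℝ) (u : ℝ → E3 → E3) (Cg Cu : ℝ) : Prop where
  smooth : ∀ t < 0, ContDiff ℝ ∞ (f t)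
  cont_fderiv : ContinuousOn (fun p : ℝ × E3 => fderiv ℝ (f p.1) p.2) (Iio 0 ×ˢ univ)
  cont_laplacian : ContinuousOn (fun p : ℝ × E3 => (Δ (f p.1)) p.2) (Iio 0 ×ˢ univ)
  axis : ∀ t < 0, ∀ x, |f t x| ≤ Cg * cylRadius x
  meas : Measurable (uncurry u)
  drift : ∀ t < 0, ∀ x, ‖u t x‖ ≤ Cu
  eqn : ∀ x, cylRadius x ≠ 0 → ∀ s t : ℝ, s ≤ t → t < 0 →
    f t x - f s x = ∫ τ in s..t, ((Δ (f τ)) x - fderiv ℝ (f τ) x (u τ x) -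
      2 / cylRadius x * partialDeriv (eR x) (f τ) x)

/-- The merged drift `b = u + (2/r) e_r` of the swirl equation (KNSS (5.10)). -/
def mergedDrift (u : ℝ → E3 → E3) : ℝ → E3 → E3 := fun t x => u t x + (2 / cylRadius x) • eR x

/-- PROVED. The integrand of (5.10) is the drift–heat integrand for the merged drift. -/
theorem swirl_integrand_merged (g : E3 → ℝ) (v : E3) (x : E3) :
    (Δ g) x - fderiv ℝ g x v - 2 / cylRadius x * partialDeriv (eR x) g x =
      (Δ g) x - fderiv ℝ g x (v + (2 / cylRadius x) • eR x) := by
  simp only [partialDeriv, map_add, map_smul, smul_eq_mul]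
  ring

/-- PROVED. `‖e_r‖ ≤ 1` (junk value `0` on the axis). -/
theorem norm_eR_le_one (x : E3) : ‖eR x‖ ≤ 1 := by
  by_cases hx : cylRadius x = 0
  · have h0 : eR x = 0 := by simp [eR, hx]
    rw [h0, norm_zero]; exact zero_le_one
  · have hpos : 0 < cylRadius x := lt_of_le_of_ne (cylRadius_nonneg x) (Ne.symm hx)
    have hn : ‖(WithLp.toLp 2 ![x 0, x 1, 0] : E3)‖ = cylRadius x := by
      rw [EuclideanSpace.norm_eq, cylRadius]
      congr 1
      simp [Fin.sum_univ_three]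
    rw [eR, norm_smul, hn, Real.norm_eq_abs, abs_of_pos (inv_pos.2 hpos), inv_mul_cancel₀ hx]

/-- PROVED. **A swirl pair is a local drift–heat solution off the axis**: on `(−∞,0) × {r > a}` (`a > 0`) the pair
`(f, u)` is in `IsDriftHeatSolutionOn (u + (2/r)e_r) f (|C_u| + 2/a)`. This is the input of the comparison tool S1. -/
theorem IsSwirlPair.driftHeat {f : ℝ → E3 → ℝ} {u : ℝ → E3 → E3} {Cg Cu : ℝ} (hp : IsSwirlPair f u Cg Cu)
    {a : ℝ} (ha : 0 < a) :
    IsDriftHeatSolutionOn (mergedDrift u) f (|Cu| + 2 / a) (Iio 0) {x : E3 | a < cylRadius x} where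
  measurable_drift := measurable_uncurry_swirlDrift hp.meas
  norm_drift_le t ht x hx := by
    have hr : a < cylRadius x := hx
    have hr0 : 0 < cylRadius x := ha.trans hr
    have h1 : ‖u t x‖ ≤ |Cu| := (hp.drift t ht x).trans (le_abs_self Cu)
    have h2 : ‖(2 / cylRadius x) • eR x‖ ≤ 2 / a := by
      rw [norm_smul, Real.norm_eq_abs, abs_of_nonneg (by positivity)]
      calc 2 / cylRadius x * ‖eR x‖ ≤ 2 / cylRadius x * 1 := by
            gcongr; exact norm_eR_le_one x
        _ ≤ 2 / a := by rw [mul_one]; exact div_le_div_of_nonneg_left (by norm_num) ha hr.le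
    exact (norm_add_le _ _).trans (add_le_add h1 h2)
  contDiffOn t ht := ((hp.smooth t ht).of_le (by norm_cast)).contDiffOn
  continuousOn_fderiv := hp.cont_fderiv.mono (prod_mono Subset.rfl (subset_univ _))
  continuousOn_laplacian := hp.cont_laplacian.mono (prod_mono Subset.rfl (subset_univ _))
  integral_eq x hx s hs t ht hst := by
    have hr0 : cylRadius x ≠ 0 := (ha.trans hx).ne'
    rw [hp.eqn x hr0 s t hst ht]
    refine intervalIntegral.integral_congr fun τ _ => ?_
    exact swirl_integrand_merged (f τ) (u τ x) x

/-! ## §2  The dictionary of the line, certified (PROVED): for a radial `W(x) = w(r)` the swirl operator is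
`ΔW − DW[u + (2/r)e_r] = w″ + ((m−1)/r) w′`, `m := −(x₀u₀ + x₁u₁) = −r u_r` the INFLOW NUMBER (Bessel dimension of
`r = cylRadius` along the backward meridional diffusion). Boundedness alone gives `m ≤ |C_u| r`; the one-sided
hypothesis gives `m ≤ 2 − δ` on `{r ≥ R₀}`. Two explicit profiles are super-solutions ROBUSTLY in these two regimes:
the core profile `1 − ψ` (ψ = worst-case scale function of dimension `c r`, closed form) and the far profile `r^δ`. -/

/-- The worst-case scale function of the core, in closed form: `G(ρ) = ∫_ρ^∞ s e^{−cs} ds = (cρ+1)e^{−cρ}/c²`. -/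
def coreG (c ρ : ℝ) : ℝ := (c * ρ + 1) * Real.exp (-(c * ρ)) / c ^ 2

/-- The core profile on `[0, L]`: `ψ(r) = (G(r) − G(L))/(G(0) − G(L))`, `ψ(0) = 1`, `ψ(L) = 0`, decreasing;
it solves `ψ″ + (c − 1/r)ψ′ = 0`, i.e. it is harmonic for the LARGEST admissible dimension `m = c r`. -/
def corePsi (c L r : ℝ) : ℝ := (coreG c r - coreG c L) / (coreG c 0 - coreG c L)

/-- The core-leak fraction of the line: `p₀ = ψ(R₁)` with `c = |C_u| + 1`, `L = R₁ + 1`. -/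
def coreLeakFraction (Cu R₁ : ℝ) : ℝ := corePsi (|Cu| + 1) (R₁ + 1) R₁

/-- PROVED. `G′(ρ) = −ρ e^{−cρ}` (`c ≠ 0`). -/
theorem hasDerivAt_coreG {c : ℝ} (hc : c ≠ 0) (ρ : ℝ) :
    HasDerivAt (coreG c) (-(ρ * Real.exp (-(c * ρ)))) ρ := by
  unfold coreG
  have h1 : HasDerivAt (fun ρ : ℝ => c * ρ + 1) c ρ :=
    (((hasDerivAt_id' ρ).const_mul c).add_const 1).congr_deriv (by ring)
  have h2 : HasDerivAt (fun ρ : ℝ => Real.exp (-(c * ρ))) (Real.exp (-(c * ρ)) * (-c)) ρ := by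
    have : HasDerivAt (fun ρ : ℝ => -(c * ρ)) (-c) ρ :=
      (((hasDerivAt_id' ρ).const_mul c).neg).congr_deriv (by ring)
    exact this.exp
  have h3 := (h1.mul h2).div_const (c ^ 2)
  refine h3.congr_deriv ?_
  field_simp
  ring

/-- PROVED. `G` is strictly decreasing on `[0, ∞)` for `c > 0`. -/
theorem strictAntiOn_coreG {c : ℝ} (hc : 0 < c) : StrictAntiOn (coreG c) (Ici 0) := by
  have hcont : ContinuousOn (coreG c) (Ici 0) := fun ρ _ =>
    (hasDerivAt_coreG hc.ne' ρ).continuousAt.continuousWithinAt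
  refine strictAntiOn_of_deriv_neg (convex_Ici 0) hcont ?_
  intro ρ hρ
  rw [interior_Ici] at hρ
  rw [(hasDerivAt_coreG hc.ne' ρ).deriv]
  have : 0 < ρ * Real.exp (-(c * ρ)) := mul_pos hρ (Real.exp_pos _)
  linarith

/-- PROVED. `ψ(0) = 1` and `ψ(L) = 0` (for `L > 0`, `c > 0`). -/
theorem corePsi_zero_and_L {c L : ℝ} (hc : 0 < c) (hL : 0 < L) :
    corePsi c L 0 = 1 ∧ corePsi c L L = 0 := by
  have hlt : coreG c L < coreG c 0 := strictAntiOn_coreG hc (le_refl (0:ℝ)) hL.le hL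
  have hne : coreG c 0 - coreG c L ≠ 0 := by linarith
  unfold corePsi
  exact ⟨div_self hne, by rw [sub_self, zero_div]⟩

/-- PROVED. **The core-leak fraction is a genuine fraction**: `ψ(R₁) ∈ (0, 1)` for `0 < R₁ < L`, `c > 0`. -/
theorem corePsi_mem_Ioo {c L R₁ : ℝ} (hc : 0 < c) (hR₁ : 0 < R₁) (hL : R₁ < L) :
    corePsi c L R₁ ∈ Ioo (0 : ℝ) 1 := by
  have h1 : coreG c L < coreG c R₁ := strictAntiOn_coreG hc hR₁.le (hR₁.trans hL).le hL
  have h2 : coreG c R₁ < coreG c 0 := strictAntiOn_coreG hc (le_refl (0:ℝ)) hR₁.le hR₁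
  unfold corePsi
  refine ⟨div_pos (by linarith) (by linarith), (div_lt_one (by linarith)).2 (by linarith)⟩

/-- PROVED. `p₀ = coreLeakFraction C_u R₁ ∈ (0, 1)` for `R₁ > 0`. -/
theorem coreLeakFraction_mem_Ioo (Cu : ℝ) {R₁ : ℝ} (hR₁ : 0 < R₁) :
    coreLeakFraction Cu R₁ ∈ Ioo (0 : ℝ) 1 :=
  corePsi_mem_Ioo (by positivity) hR₁ (by linarith)

/-- PROVED. `ψ′(r) = −r e^{−cr} / (G(0) − G(L))`. -/
theorem hasDerivAt_corePsi {c : ℝ} (hc : c ≠ 0) (L r : ℝ) :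
    HasDerivAt (corePsi c L) (-(r * Real.exp (-(c * r))) / (coreG c 0 - coreG c L)) r := by
  unfold corePsi
  exact ((hasDerivAt_coreG hc r).sub_const _).div_const _

/-- PROVED (dictionary row «core»). **The core profile is a ROBUST sub-solution.** With `ψ′ = −A r e^{−cr}` (`A ≥ 0`) and
`ψ″ = −A e^{−cr}(1 − cr)`: for EVERY inflow number `m ≤ c r`, `ψ″ + ((m−1)/r) ψ′ = A e^{−cr}(cr − m) ≥ 0`; hence
`F(1 − ψ)` is a super-solution of the swirl operator wherever `−r u_r ≤ c r`, which boundedness `‖u‖ ≤ c` guarantees. -/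
theorem coreProfile_subsolution {A c r m : ℝ} (hA : 0 ≤ A) (hr : 0 < r) (hm : m ≤ c * r) :
    0 ≤ -(A * Real.exp (-(c * r)) * (1 - c * r)) + (m - 1) / r * (-(A * r * Real.exp (-(c * r)))) := by
  have h : -(A * Real.exp (-(c * r)) * (1 - c * r)) + (m - 1) / r * (-(A * r * Real.exp (-(c * r))))
      = A * Real.exp (-(c * r)) * (c * r - m) := by
    field_simp
    ring
  rw [h]
  exact mul_nonneg (mul_nonneg hA (Real.exp_pos _).le) (by linarith)

/-- PROVED (sharpness of the core row). Where the inflow number EXCEEDS `c r` the core profile fails: the sign flips. -/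
theorem coreProfile_fails {A c r m : ℝ} (hA : 0 < A) (hr : 0 < r) (hm : c * r < m) :
    -(A * Real.exp (-(c * r)) * (1 - c * r)) + (m - 1) / r * (-(A * r * Real.exp (-(c * r)))) < 0 := by
  have h : -(A * Real.exp (-(c * r)) * (1 - c * r)) + (m - 1) / r * (-(A * r * Real.exp (-(c * r))))
      = A * Real.exp (-(c * r)) * (c * r - m) := by
    field_simp
    ring
  rw [h]
  exact mul_neg_of_pos_of_neg (mul_pos hA (Real.exp_pos _)) (by linarith)

/-- PROVED (verbatim from g9-1). For `H(r) = r^δ`: `−H″(r) + (a + 1/r) H′(r) = δ r^{δ−2} (2 − δ + r a)` (`r > 0`). -/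
theorem powerBarrier_identity {r δ a : ℝ} (hr : 0 < r) :
    -(δ * (δ - 1) * r ^ (δ - 2)) + (a + 1 / r) * (δ * r ^ (δ - 1))
      = δ * r ^ (δ - 2) * (2 - δ + r * a) := by
  have h1 : r ^ (δ - 1) = r ^ (δ - 2) * r := by
    rw [show δ - 1 = (δ - 2) + 1 by ring, Real.rpow_add hr, Real.rpow_one]
  rw [h1]
  field_simp
  ring

/-- PROVED (dictionary row «far»). **The far profile `r^δ` is a ROBUST super-solution**: for every inflow number
`m ≤ 2 − δ` (`δ > 0`, `r > 0`), `(r^δ)″ + ((m−1)/r)(r^δ)′ = δ r^{δ−2}(δ − 2 + m) ≤ 0`. -/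
theorem farProfile_supersolution {r δ m : ℝ} (hr : 0 < r) (hδ : 0 < δ) (hm : m ≤ 2 - δ) :
    δ * (δ - 1) * r ^ (δ - 2) + (m - 1) / r * (δ * r ^ (δ - 1)) ≤ 0 := by
  have h := powerBarrier_identity (δ := δ) (a := -m / r) hr
  have hid : δ * (δ - 1) * r ^ (δ - 2) + (m - 1) / r * (δ * r ^ (δ - 1))
      = -( -(δ * (δ - 1) * r ^ (δ - 2)) + (-m / r + 1 / r) * (δ * r ^ (δ - 1))) := by
    field_simp
    ring
  rw [hid, h]
  have hpow : 0 < r ^ (δ - 2) := Real.rpow_pos_of_pos hr _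
  have hra : r * (-m / r) = -m := by field_simp
  rw [hra]
  have h2 : 0 ≤ 2 - δ + -m := by linarith
  have : 0 ≤ δ * r ^ (δ - 2) * (2 - δ + -m) := by positivity
  linarith

/-- PROVED (the initial-data corrector). `Φ(r) = 2e^{γR} − e^{γr}` on `[R₁, R]` absorbs ANY radial coefficient
`|κ| ≤ K < γ` at the exponential rate `μ = γ(γ−K)e^{−γ(R−R₁)}/2`: `Φ″ + κ Φ′ + μ Φ ≤ 0`; so `F e^{−μ(t−t_b)} Φ(r)` is a
super-solution that dominates `F` at `t = t_b` (`Φ ≥ 1`) and decays as `t − t_b → ∞`. -/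
theorem initialCorrector_ineq {γ K R₁ R r κ : ℝ} (hK : 0 ≤ K) (hγ : K < γ) (hr₁ : R₁ ≤ r)
    (hκ : |κ| ≤ K) :
    -(γ ^ 2 * Real.exp (γ * r)) + κ * (-(γ * Real.exp (γ * r)))
      + γ * (γ - K) * Real.exp (-(γ * (R - R₁))) / 2 * (2 * Real.exp (γ * R) - Real.exp (γ * r)) ≤ 0 := by
  have hγ0 : 0 < γ := lt_of_le_of_lt hK hγ
  have her : 0 < Real.exp (γ * r) := Real.exp_pos _
  have heR : 0 < Real.exp (γ * R) := Real.exp_pos _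
  have hkey : Real.exp (-(γ * (R - R₁))) * Real.exp (γ * R) = Real.exp (γ * R₁) := by
    rw [← Real.exp_add]; congr 1; ring
  have hmono : Real.exp (γ * R₁) ≤ Real.exp (γ * r) := Real.exp_le_exp.2 (by nlinarith)
  have hge : 0 < γ * Real.exp (γ * r) := mul_pos hγ0 her
  have hκ' : κ * (-(γ * Real.exp (γ * r))) ≤ K * (γ * Real.exp (γ * r)) := by
    have h1 : -κ ≤ K := by linarith [neg_abs_le κ, hκ, abs_nonneg κ, neg_le_abs κ]
    calc κ * (-(γ * Real.exp (γ * r))) = (-κ) * (γ * Real.exp (γ * r)) := by ring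
      _ ≤ K * (γ * Real.exp (γ * r)) := mul_le_mul_of_nonneg_right h1 hge.le
  have hμ0 : 0 ≤ γ * (γ - K) * Real.exp (-(γ * (R - R₁))) / 2 := by
    have : 0 ≤ γ * (γ - K) := mul_nonneg hγ0.le (by linarith)
    positivity
  have hsplit : γ * (γ - K) * Real.exp (-(γ * (R - R₁))) / 2 * (2 * Real.exp (γ * R) - Real.exp (γ * r))
      ≤ γ * (γ - K) * Real.exp (γ * R₁) := by
    have h1 : γ * (γ - K) * Real.exp (-(γ * (R - R₁))) / 2 * (2 * Real.exp (γ * R) - Real.exp (γ * r))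
        = γ * (γ - K) * (Real.exp (-(γ * (R - R₁))) * Real.exp (γ * R))
          - γ * (γ - K) * Real.exp (-(γ * (R - R₁))) / 2 * Real.exp (γ * r) := by ring
    rw [h1, hkey]
    have : 0 ≤ γ * (γ - K) * Real.exp (-(γ * (R - R₁))) / 2 * Real.exp (γ * r) := mul_nonneg hμ0 her.le
    linarith
  have hγK : 0 ≤ γ * (γ - K) := mul_nonneg hγ0.le (by linarith)
  have hm := mul_le_mul_of_nonneg_left hmono hγK
  have hring : -(γ ^ 2 * Real.exp (γ * r)) + K * (γ * Real.exp (γ * r)) + γ * (γ - K) * Real.exp (γ * r) = 0 := by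
    ring
  linarith

/-- PROVED. `Φ ≥ 1` on `r ≤ R` (`γ ≥ 0`, `R ≥ 0`). -/
theorem initialCorrector_ge_one {γ R r : ℝ} (hγ : 0 ≤ γ) (hR : 0 ≤ R) (hrR : r ≤ R) :
    1 ≤ 2 * Real.exp (γ * R) - Real.exp (γ * r) := by
  have h1 : Real.exp (γ * r) ≤ Real.exp (γ * R) := Real.exp_le_exp.2 (by nlinarith)
  have h2 : 1 ≤ Real.exp (γ * R) := Real.one_le_exp (mul_nonneg hγ hR)
  linarith

/-- PROVED (the lateral corrector for the z-truncation). `h(t,z) = F e^{ν(t−t_b)} cosh(β(z − z*))/cosh(βZ)` is a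
super-solution as soon as `ν ≥ β² + C β` (`|u_z| ≤ C`): `β² cosh − u_z β sinh ≤ ν cosh`. -/
theorem lateralCorrector_ineq {β ν C uz co si : ℝ} (hco : 0 < co) (hsi : |si| ≤ co) (huz : |uz| ≤ C)
    (hβ : 0 ≤ β) (hν : β ^ 2 + C * β ≤ ν) : β ^ 2 * co - uz * (β * si) ≤ ν * co := by
  have h1 : -(uz * si) ≤ C * co := by
    have : |uz * si| ≤ C * co := by
      rw [abs_mul]; exact mul_le_mul huz hsi (abs_nonneg _) ((abs_nonneg _).trans huz)
    linarith [neg_abs_le (uz * si)]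
  nlinarith



end Summit.NavierStokesRegularity.NavierStokesRegularity.Theorems.ScenarioCensus.FellerSwirl

end
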